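import Summits.Ventures.HSemireg.WedgeHankelRecurrenceGaussChebyshevSRootsReal

/-!
# Venture HSemireg — **THE REAL ROOTS OF THE HALF-ANGLE POLYNOMIALS `S_k + S_{k−1}` AND `S_k − S_{k−1}`: `(S_k + S_{k−1}).roots = {2cos(2jπ∕(2k+1)) : 1 ≤ j ≤ k}`,
# `(S_k − S_{k−1}).roots = {2cos((2j+1)π∕(2k+1)) : 0 ≤ j < k}`** (all simple; both polynomials monic of degree `k`), with the root tests and the real factorisations — read off from the
# monic half-angle identities `C_{2k+1} − 2 = (X − 2)(S_k + S_{k−1})²`, `C_{2k+1} + 2 = (X + 2)(S_k − S_{k−1})²` (N485) and `C_n(2cos θ) = 2cos nθ`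

HONEST FRAMING. Part of the Lean index of the computation cell `pub-hsemireg` (seat p10 gen 49, Sunday typer «UNIFORM-IN-n»).  Real polynomial algebra and trigonometry only (Mathlib
`Polynomial.Chebyshev.S ∕ C`, `Polynomial.roots`, `Real.cos`); no variety, no cohomology theory, no sheaf, no Ext group and no semiregularity map is constructed here; nothing here says that
HC / HC_CM / HC_AV holds; no Literature fact (unproved `Prop`) is declared or used.  Custodian versions as in `WedgeHankelSiegelIdeal` (1/3).
SOURCES (cited).  P. Ribenboim, *My Numbers, My Friends* (2000), Ch. 1 §IV (the factorisations of `V_{2k+1} ∓ 2`); A. F. Horadam, Fibonacci Quart. 40 (2002) 223–232 (zeros of the Vieta polynomials);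
T. J. Rivlin, *The Chebyshev Polynomials* (1974), §1.2; W. Watkins, J. Zeitlin, Amer. Math. Monthly 100 (1993) 471–474 (the minimal polynomial of `cos(2π∕n)` via `T`-polynomials — the
polynomials `S_k ± S_{k−1}` are the `ℝ`-split factors of `C_{2k+1} ∓ 2` carrying the roots `2cos(2jπ∕(2k+1))`, `2cos((2j+1)π∕(2k+1))`).
PROOF TYPED HERE.  At `x = 2cos θ` with `θ = 2jπ∕(2k+1)` (resp. `(2j+1)π∕(2k+1)`), Mathlib `C_two_mul_real_cos` gives `C_{2k+1}(x) = 2cos(2jπ) = 2` (resp. `2cos((2j+1)π) = −2`); since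
`0 < θ < π` one has `cos θ ≠ ±1`, so `x ∓ 2 ≠ 0` and the N485 identities force `(S_k ± S_{k−1})(x)² = 0`.  The `k` angles lie in `(0, π)` and are distinct (`Real.injOn_cos`); the degree
count (`deg = k`, monic, from N465 `chebyshevS_natDegree_monic`) closes with Mathlib `roots_eq_of_degree_eq_card`; products from `prod_multiset_X_sub_C_of_monic_of_roots_card_eq`.
DEDUP DISCLOSURE (`rg -n 'S_add_pred|S_sub_pred|HalfAngle' Summits/Ventures/HSemireg`, `lean search`, 2026-09-04): N485 has the polynomial identities and N478 the `T`-forms; no root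
statement for `S_k ± S_{k−1}` is in the tree or in Mathlib; 0 hits for the 11 names below.

WHAT IS IN THE TREE.  N485 `chebyshevC_two_mul_add_one_sub_two ∕ _add_two`; N465 `chebyshevS_natDegree_monic`; N500 (roots of `S_n`, `C_n`); Mathlib `C_two_mul_real_cos`, `injOn_cos`.
THIS FILE (namespace `Summit.Ventures.HSemireg.Wedge.HankelOuter` continued; CHAINED on N500; 0 definitions):
* §1266 `cos_ne_one_and_ne_neg_one_of_pos_of_lt_pi`, `chebyshevS_add_pred_natDegree_monic`, `chebyshevS_sub_pred_natDegree_monic`, `chebyshevS_add_pred_roots_real_nodup`,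
  **`chebyshevS_add_pred_roots_real`**, **`chebyshevS_add_pred_eval_eq_zero_iff_real`**, `chebyshevS_add_pred_eq_prod_real`, `chebyshevS_sub_pred_roots_real_nodup`,
  **`chebyshevS_sub_pred_roots_real`**, **`chebyshevS_sub_pred_eval_eq_zero_iff_real`**, `chebyshevS_sub_pred_eq_prod_real`.
CAVEATS.  `k ∈ ℕ` (`k = 0`: both polynomials are `1`, no roots).  Nothing Ext-side.  New names only.
-/

open Module Polynomial Real
open scoped Matrix Polynomial

namespace Summit.Ventures.HSemireg.Wedge.HankelOuter

/-! ## §1266. Real roots of `S_k ± S_{k−1}` -/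

/-- For `0 < θ < π`: `cos θ ≠ 1` and `cos θ ≠ −1` (`sin θ > 0`). [bookkeeping; this file, §1266] -/
theorem cos_ne_one_and_ne_neg_one_of_pos_of_lt_pi {θ : ℝ} (h0 : 0 < θ) (hπ : θ < π) : cos θ ≠ 1 ∧ cos θ ≠ -1 := by
  have hs := sin_pos_of_pos_of_lt_pi h0 hπ
  have h := sin_sq_add_cos_sq θ
  constructor <;> intro hc <;> rw [hc] at h <;> nlinarith

/-- `S_k + S_{k−1}` is monic of degree `k` (`k ∈ ℕ`, nontrivial commutative ring). [bookkeeping; this file, §1266] -/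
theorem chebyshevS_add_pred_natDegree_monic {R : Type*} [CommRing R] [Nontrivial R] (k : ℕ) :
    (Polynomial.Chebyshev.S R (k : ℤ) + Polynomial.Chebyshev.S R ((k : ℤ) - 1)).natDegree = k ∧
      (Polynomial.Chebyshev.S R (k : ℤ) + Polynomial.Chebyshev.S R ((k : ℤ) - 1)).Monic := by
  rcases Nat.eq_zero_or_pos k with rfl | hk
  · simp only [Nat.cast_zero, Polynomial.Chebyshev.S_zero, zero_sub, Polynomial.Chebyshev.S_neg_one, add_zero, natDegree_one, monic_one, and_self]
  obtain ⟨j, rfl⟩ := Nat.exists_eq_succ_of_ne_zero hk.ne'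
  obtain ⟨hd, hm⟩ := chebyshevS_natDegree_monic (R := R) (j + 1)
  obtain ⟨hd', -⟩ := chebyshevS_natDegree_monic (R := R) j
  have hidx : ((j + 1 : ℕ) : ℤ) - 1 = (j : ℤ) := by push_cast; ring
  have hlt : (Polynomial.Chebyshev.S R (j : ℤ)).natDegree < (Polynomial.Chebyshev.S R ((j + 1 : ℕ) : ℤ)).natDegree := by rw [hd, hd']; omega
  rw [Nat.succ_eq_add_one, hidx]
  exact ⟨by rw [natDegree_add_eq_left_of_natDegree_lt hlt, hd], hm.add_of_left (degree_lt_degree hlt)⟩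

/-- `S_k − S_{k−1}` is monic of degree `k` (`k ∈ ℕ`, nontrivial commutative ring). [bookkeeping; this file, §1266] -/
theorem chebyshevS_sub_pred_natDegree_monic {R : Type*} [CommRing R] [Nontrivial R] (k : ℕ) :
    (Polynomial.Chebyshev.S R (k : ℤ) - Polynomial.Chebyshev.S R ((k : ℤ) - 1)).natDegree = k ∧
      (Polynomial.Chebyshev.S R (k : ℤ) - Polynomial.Chebyshev.S R ((k : ℤ) - 1)).Monic := by
  rcases Nat.eq_zero_or_pos k with rfl | hk
  · simp only [Nat.cast_zero, Polynomial.Chebyshev.S_zero, zero_sub, Polynomial.Chebyshev.S_neg_one, sub_zero, natDegree_one, monic_one, and_self]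
  obtain ⟨j, rfl⟩ := Nat.exists_eq_succ_of_ne_zero hk.ne'
  obtain ⟨hd, hm⟩ := chebyshevS_natDegree_monic (R := R) (j + 1)
  obtain ⟨hd', -⟩ := chebyshevS_natDegree_monic (R := R) j
  have hidx : ((j + 1 : ℕ) : ℤ) - 1 = (j : ℤ) := by push_cast; ring
  have hlt : (Polynomial.Chebyshev.S R (j : ℤ)).natDegree < (Polynomial.Chebyshev.S R ((j + 1 : ℕ) : ℤ)).natDegree := by rw [hd, hd']; omega
  rw [Nat.succ_eq_add_one, hidx]
  exact ⟨by rw [natDegree_sub_eq_left_of_natDegree_lt hlt, hd], hm.sub_of_left (degree_lt_degree hlt)⟩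

/-- The points `2cos(2(j+1)π∕(2k+1))`, `j < k`, are pairwise distinct. [this file, §1266] -/
theorem chebyshevS_add_pred_roots_real_nodup (k : ℕ) :
    ((Multiset.range k).map fun j : ℕ => 2 * cos (2 * (j + 1) * π / (2 * k + 1))).Nodup := by
  refine (Multiset.nodup_range k).map_on fun i hi j hj hij => ?_
  have hi : i < k := Multiset.mem_range.mp hi
  have hj : j < k := Multiset.mem_range.mp hj
  have hmem : ∀ m : ℕ, m < k → 2 * ((m : ℝ) + 1) * π / (2 * k + 1) ∈ Set.Icc 0 π := fun m hm => by
    refine ⟨by positivity, ?_⟩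
    rw [div_le_iff₀ (by positivity)]
    have : (m : ℝ) + 1 ≤ k := by exact_mod_cast Nat.lt_iff_add_one_le.mp hm
    nlinarith [pi_pos]
  have h := injOn_cos (hmem i hi) (hmem j hj) (mul_left_cancel₀ two_ne_zero hij)
  rw [div_left_inj' (by positivity)] at h
  have h' : (i : ℝ) = j := by nlinarith [pi_pos]
  exact Nat.cast_injective h'

/-- **`(S_k + S_{k−1}).roots = {2cos(2(j+1)π∕(2k+1)) : j < k}` over `ℝ`** (as a multiset: every root simple). [Ribenboim Ch. 1 §IV; Horadam 2002; this file, §1266] -/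
theorem chebyshevS_add_pred_roots_real (k : ℕ) :
    (Polynomial.Chebyshev.S ℝ (k : ℤ) + Polynomial.Chebyshev.S ℝ ((k : ℤ) - 1)).roots = (Multiset.range k).map fun j : ℕ => 2 * cos (2 * (j + 1) * π / (2 * k + 1)) := by
  classical
  have hnd := chebyshevS_add_pred_roots_real_nodup k
  have hfin : ((Multiset.range k).map fun j : ℕ => 2 * cos (2 * (j + 1) * π / (2 * k + 1))) =
      (((Multiset.range k).map fun j : ℕ => 2 * cos (2 * (j + 1) * π / (2 * k + 1))).toFinset).val := by
    rw [Multiset.toFinset_val, Multiset.dedup_eq_self.mpr hnd]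
  rw [hfin]
  refine roots_eq_of_degree_eq_card (fun x hx => ?_) ?_
  · obtain ⟨j, hj, rfl⟩ := Multiset.mem_map.mp (Multiset.mem_toFinset.mp hx)
    have hj : j < k := Multiset.mem_range.mp hj
    set θ : ℝ := 2 * ((j : ℝ) + 1) * π / (2 * k + 1) with hθ
    have hθpos : 0 < θ := by positivity
    have hθlt : θ < π := by
      rw [hθ, div_lt_iff₀ (by positivity)]
      have : (j : ℝ) + 1 ≤ k := by exact_mod_cast Nat.lt_iff_add_one_le.mp hj
      nlinarith [pi_pos]
    have hC : (Polynomial.Chebyshev.C ℝ (2 * (k : ℤ) + 1)).eval (2 * cos θ) = 2 := by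
      rw [Polynomial.Chebyshev.C_two_mul_real_cos, show (((2 * (k : ℤ) + 1 : ℤ)) : ℝ) * θ = ((j + 1 : ℕ) : ℝ) * (2 * π) by rw [hθ]; push_cast; field_simp,
        cos_nat_mul_two_pi, mul_one]
    have hfac := congrArg (Polynomial.eval (2 * cos θ)) (chebyshevC_two_mul_add_one_sub_two (R := ℝ) (k : ℤ))
    simp only [eval_sub, eval_mul, eval_pow, eval_X, eval_ofNat, hC, sub_self] at hfac
    have hne : 2 * cos θ - 2 ≠ 0 := fun h => (cos_ne_one_and_ne_neg_one_of_pos_of_lt_pi hθpos hθlt).1 (by linarith)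
    exact eq_zero_of_pow_eq_zero ((mul_eq_zero.mp hfac.symm).resolve_left hne)
  · rw [Multiset.card_toFinset, Multiset.dedup_eq_self.mpr hnd, Multiset.card_map, Multiset.card_range]
    obtain ⟨hdeg, hmonic⟩ := chebyshevS_add_pred_natDegree_monic (R := ℝ) k
    rw [degree_eq_natDegree hmonic.ne_zero, hdeg]

/-- **Root test: `(S_k + S_{k−1})(x) = 0 ⇔ x = 2cos(2(j+1)π∕(2k+1))` for some `j < k`** (`x ∈ ℝ`). [this file, §1266] -/
theorem chebyshevS_add_pred_eval_eq_zero_iff_real (k : ℕ) (x : ℝ) :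
    (Polynomial.Chebyshev.S ℝ (k : ℤ) + Polynomial.Chebyshev.S ℝ ((k : ℤ) - 1)).eval x = 0 ↔ ∃ j < k, x = 2 * cos (2 * (j + 1) * π / (2 * k + 1)) := by
  have hne := (chebyshevS_add_pred_natDegree_monic (R := ℝ) k).2.ne_zero
  rw [← Polynomial.IsRoot.def, ← mem_roots hne, chebyshevS_add_pred_roots_real, Multiset.mem_map]
  constructor
  · rintro ⟨j, hj, rfl⟩; exact ⟨j, Multiset.mem_range.mp hj, rfl⟩
  · rintro ⟨j, hj, rfl⟩; exact ⟨j, Multiset.mem_range.mpr hj, rfl⟩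

/-- **`S_k + S_{k−1} = ∏_{j<k} (X − 2cos(2(j+1)π∕(2k+1)))` over `ℝ`.** [this file, §1266] -/
theorem chebyshevS_add_pred_eq_prod_real (k : ℕ) :
    Polynomial.Chebyshev.S ℝ (k : ℤ) + Polynomial.Chebyshev.S ℝ ((k : ℤ) - 1) = ∏ j ∈ Finset.range k, (Polynomial.X - Polynomial.C (2 * cos (2 * (j + 1) * π / (2 * k + 1)))) := by
  obtain ⟨hdeg, hmonic⟩ := chebyshevS_add_pred_natDegree_monic (R := ℝ) k
  have h := prod_multiset_X_sub_C_of_monic_of_roots_card_eq hmonic (by rw [chebyshevS_add_pred_roots_real, Multiset.card_map, Multiset.card_range, hdeg])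
  rw [← h, chebyshevS_add_pred_roots_real, Multiset.map_map, Finset.prod_eq_multiset_prod, Finset.range_val]
  rfl

/-- The points `2cos((2j+1)π∕(2k+1))`, `j < k`, are pairwise distinct. [this file, §1266] -/
theorem chebyshevS_sub_pred_roots_real_nodup (k : ℕ) :
    ((Multiset.range k).map fun j : ℕ => 2 * cos ((2 * j + 1) * π / (2 * k + 1))).Nodup := by
  refine (Multiset.nodup_range k).map_on fun i hi j hj hij => ?_
  have hi : i < k := Multiset.mem_range.mp hi
  have hj : j < k := Multiset.mem_range.mp hj
  have hmem : ∀ m : ℕ, m < k → (2 * (m : ℝ) + 1) * π / (2 * k + 1) ∈ Set.Icc 0 π := fun m hm => by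
    refine ⟨by positivity, ?_⟩
    rw [div_le_iff₀ (by positivity)]
    have : (m : ℝ) + 1 ≤ k := by exact_mod_cast Nat.lt_iff_add_one_le.mp hm
    nlinarith [pi_pos]
  have h := injOn_cos (hmem i hi) (hmem j hj) (mul_left_cancel₀ two_ne_zero hij)
  rw [div_left_inj' (by positivity)] at h
  have h' : (i : ℝ) = j := by nlinarith [pi_pos]
  exact Nat.cast_injective h'

/-- **`(S_k − S_{k−1}).roots = {2cos((2j+1)π∕(2k+1)) : j < k}` over `ℝ`** (as a multiset: every root simple). [Ribenboim Ch. 1 §IV; Horadam 2002; this file, §1266] -/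
theorem chebyshevS_sub_pred_roots_real (k : ℕ) :
    (Polynomial.Chebyshev.S ℝ (k : ℤ) - Polynomial.Chebyshev.S ℝ ((k : ℤ) - 1)).roots = (Multiset.range k).map fun j : ℕ => 2 * cos ((2 * j + 1) * π / (2 * k + 1)) := by
  classical
  have hnd := chebyshevS_sub_pred_roots_real_nodup k
  have hfin : ((Multiset.range k).map fun j : ℕ => 2 * cos ((2 * j + 1) * π / (2 * k + 1))) =
      (((Multiset.range k).map fun j : ℕ => 2 * cos ((2 * j + 1) * π / (2 * k + 1))).toFinset).val := by
    rw [Multiset.toFinset_val, Multiset.dedup_eq_self.mpr hnd]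
  rw [hfin]
  refine roots_eq_of_degree_eq_card (fun x hx => ?_) ?_
  · obtain ⟨j, hj, rfl⟩ := Multiset.mem_map.mp (Multiset.mem_toFinset.mp hx)
    have hj : j < k := Multiset.mem_range.mp hj
    set θ : ℝ := (2 * (j : ℝ) + 1) * π / (2 * k + 1) with hθ
    have hθpos : 0 < θ := by positivity
    have hθlt : θ < π := by
      rw [hθ, div_lt_iff₀ (by positivity)]
      have : (j : ℝ) + 1 ≤ k := by exact_mod_cast Nat.lt_iff_add_one_le.mp hj
      nlinarith [pi_pos]
    have hC : (Polynomial.Chebyshev.C ℝ (2 * (k : ℤ) + 1)).eval (2 * cos θ) = -2 := by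
      rw [Polynomial.Chebyshev.C_two_mul_real_cos, show (((2 * (k : ℤ) + 1 : ℤ)) : ℝ) * θ = ((2 * j + 1 : ℕ) : ℝ) * π by rw [hθ]; push_cast; field_simp,
        cos_nat_mul_pi, pow_succ, pow_mul, neg_one_sq, one_pow, one_mul, mul_neg_one]
    have hfac := congrArg (Polynomial.eval (2 * cos θ)) (chebyshevC_two_mul_add_one_add_two (R := ℝ) (k : ℤ))
    simp only [eval_add, eval_mul, eval_pow, eval_X, eval_ofNat, hC, neg_add_cancel] at hfac
    have hne : 2 * cos θ + 2 ≠ 0 := fun h => (cos_ne_one_and_ne_neg_one_of_pos_of_lt_pi hθpos hθlt).2 (by linarith)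
    exact eq_zero_of_pow_eq_zero ((mul_eq_zero.mp hfac.symm).resolve_left hne)
  · rw [Multiset.card_toFinset, Multiset.dedup_eq_self.mpr hnd, Multiset.card_map, Multiset.card_range]
    obtain ⟨hdeg, hmonic⟩ := chebyshevS_sub_pred_natDegree_monic (R := ℝ) k
    rw [degree_eq_natDegree hmonic.ne_zero, hdeg]

/-- **Root test: `(S_k − S_{k−1})(x) = 0 ⇔ x = 2cos((2j+1)π∕(2k+1))` for some `j < k`** (`x ∈ ℝ`). [this file, §1266] -/
theorem chebyshevS_sub_pred_eval_eq_zero_iff_real (k : ℕ) (x : ℝ) :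
    (Polynomial.Chebyshev.S ℝ (k : ℤ) - Polynomial.Chebyshev.S ℝ ((k : ℤ) - 1)).eval x = 0 ↔ ∃ j < k, x = 2 * cos ((2 * j + 1) * π / (2 * k + 1)) := by
  have hne := (chebyshevS_sub_pred_natDegree_monic (R := ℝ) k).2.ne_zero
  rw [← Polynomial.IsRoot.def, ← mem_roots hne, chebyshevS_sub_pred_roots_real, Multiset.mem_map]
  constructor
  · rintro ⟨j, hj, rfl⟩; exact ⟨j, Multiset.mem_range.mp hj, rfl⟩
  · rintro ⟨j, hj, rfl⟩; exact ⟨j, Multiset.mem_range.mpr hj, rfl⟩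

/-- **`S_k − S_{k−1} = ∏_{j<k} (X − 2cos((2j+1)π∕(2k+1)))` over `ℝ`.** [this file, §1266] -/
theorem chebyshevS_sub_pred_eq_prod_real (k : ℕ) :
    Polynomial.Chebyshev.S ℝ (k : ℤ) - Polynomial.Chebyshev.S ℝ ((k : ℤ) - 1) = ∏ j ∈ Finset.range k, (Polynomial.X - Polynomial.C (2 * cos ((2 * j + 1) * π / (2 * k + 1)))) := by
  obtain ⟨hdeg, hmonic⟩ := chebyshevS_sub_pred_natDegree_monic (R := ℝ) k
  have h := prod_multiset_X_sub_C_of_monic_of_roots_card_eq hmonic (by rw [chebyshevS_sub_pred_roots_real, Multiset.card_map, Multiset.card_range, hdeg])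
  rw [← h, chebyshevS_sub_pred_roots_real, Multiset.map_map, Finset.prod_eq_multiset_prod, Finset.range_val]
  rfl

end Summit.Ventures.HSemireg.Wedge.HankelOuter
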